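import Literature.Geometry.Riemannian.GeneralizedCylinderMeanCurvature
import Literature.Geometry.Lorentzian.MetricValCongr
import HarnessLib

/-!
# The scalar curvature of a `C`-normal metric along the boundary (Bär–Hanke 2023, §3, after
# Def. 21)

Topic `Literature/Geometry/Riemannian`. A brick of the proof programme of
`Literature.Geometry.Riemannian.BaerHankePscGluing`. Bär–Hanke, Def. 21: a metric on `M` is
`C`-normal if near the boundary, in normal coordinates `g = dt² + g_t`, the family is the
quadratic polynomial `g_t = g_0 + t ġ_0 - C t² g_0`. After Remark 22 they note: for a
Riemannian metric `g_0` and a symmetric `h` on `Σ`, the metric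
`g = dt² + g_0 - 2t h - C t² g_0` has, ALONG `Σ`, scalar curvature
`scal_{g_0} + 3 tr(W_0²) - tr(W_0)² + 2C(n-1)` (`⟨W_0 X, Y⟩ = h(X, Y)`), by formula (scal) and
`tr_{g_0}(g̈_0) = -2C(n-1)`; hence `scal_g > σ` along `Σ` iff `C > C_0` (their (defC)).

* `cNormal_scalarCurvature_boundary` — for a Riemannian generalized cylinder `G` on `N × ℝ` whose
  slice coefficients are `G_{(z,τ)}((v,0),(w,0)) = (1 - Cτ²) g_0(v,w) + τ k(v,w)` for `|τ| < r`
  (so `ġ_0 = k`, `g̈_0 = -2C g_0`; Bär–Hanke's `k = -2h`):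
  `scal_G(z, (0 : ℝ)) = scal_{g_0}(z) + ¾ |k|²_{g_0} - ¼ (tr_{g_0} k)² + 2 C dim N`
  (`cyl_scalarCurvature_eq_sum` with `K_0 = ½ k`, `H_0 = ½ tr k`, `|K_0|² = ¼|k|²`,
  `∑ᵢ g̈_0(βᵢ,βᵢ)/aᵢ = -2C dim N`). With `k = -2h`: `¾|k|² = 3|h|² = 3 tr(W_0²)`,
  `¼(tr k)² = (tr h)² = tr(W_0)²`, `dim N = n - 1` — the printed expression.

Everything is proved; no definitions, no named facts (D-0026).

## References

* C. Bär, B. Hanke, *Boundary conditions for scalar curvature*, arXiv:2012.09127, §3, Def. 21,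
  Remark 22 and the displayed computation following it ((scal), (defC)). [BarHanke2023]
-/

noncomputable section

open Bundle Set Filter Function Metric
open scoped Manifold ContDiff Topology

namespace Literature.Geometry.Riemannian

open Literature.Geometry.Lorentzian
open Literature.Geometry.Lorentzian.PseudoRiemannianMetric

variable {E' : Type*} [NormedAddCommGroup E'] [NormedSpace ℝ E'] [FiniteDimensional ℝ E']
  {H' : Type*} [TopologicalSpace H'] {I' : ModelWithCorners ℝ E' H'} [I'.Boundaryless]
  {N : Type*} [TopologicalSpace N] [ChartedSpace H' N] [IsManifold I' ∞ N]
  (G : PseudoRiemannianMetric (I'.prod 𝓘(ℝ, ℝ)) ∞ (E' × ℝ)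
    (TangentSpace (I'.prod 𝓘(ℝ, ℝ)) : N × ℝ → Type _)) [G.HasLeviCivita]
  (g₀ : PseudoRiemannianMetric I' ∞ E' (TangentSpace I' : N → Type _)) [g₀.HasLeviCivita]

/-- Calculus of the quadratic family: `τ ↦ (1 - Cτ²) a + τ b` has derivative `b - 2Cτ a`.
[folklore] -/
theorem hasDerivAt_cNormal_coeff (C a b τ : ℝ) :
    HasDerivAt (fun τ : ℝ ↦ (1 - C * τ ^ 2) * a + τ * b) (b - 2 * C * τ * a) τ := by
  have hp : HasDerivAt (fun x : ℝ ↦ x ^ 2) (2 * τ) τ := by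
    simpa using hasDerivAt_pow 2 τ
  have h := (((hp.const_mul C).const_sub 1).mul_const a).add ((hasDerivAt_id τ).mul_const b)
  exact h.congr_deriv (by ring)

/-- … and second derivative `-2C a`. [folklore] -/
theorem hasDerivAt_deriv_cNormal_coeff (C a b τ : ℝ) :
    HasDerivAt (fun τ : ℝ ↦ deriv (fun σ : ℝ ↦ (1 - C * σ ^ 2) * a + σ * b) τ) (-2 * C * a) τ := by
  have hd : (fun τ : ℝ ↦ deriv (fun σ : ℝ ↦ (1 - C * σ ^ 2) * a + σ * b) τ) =
      fun τ ↦ b - 2 * C * τ * a := funext fun τ ↦ (hasDerivAt_cNormal_coeff C a b τ).deriv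
  rw [hd]
  have h := (((hasDerivAt_id τ).const_mul (2 * C)).mul_const a).const_sub b
  exact h.congr_deriv (by ring)

set_option maxHeartbeats 800000 in
/-- **The scalar curvature of a `C`-normal metric along the boundary** (Bär–Hanke 2023, §3, the
computation after Remark 22): if the Riemannian generalized cylinder `G = g_t + dt²` on `N × ℝ`
has `g_τ(v, w) = (1 - Cτ²) g_0(v, w) + τ k(v, w)` for `|τ| < r` (a `C`-normal family with
`ġ_0 = k`), then for every `z ∈ N`
`scal_G(z, (0 : ℝ)) = scal_{g_0}(z) + ¾ |k|²_{g_0}(z) - ¼ (tr_{g_0} k)(z)² + 2 C dim N`.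
[cite: BarHanke2023, §3, Remark 22 ff. ((scal), (defC))] -/
theorem cNormal_scalarCurvature_boundary (hG : G.IsRiemannian)
    (hcyl : ∀ (p : N × ℝ) (v w : TangentSpace (I'.prod 𝓘(ℝ, ℝ)) p),
      G.val p v w = G.val p ((v.1, 0) : TangentSpace (I'.prod 𝓘(ℝ, ℝ)) p)
        ((w.1, 0) : TangentSpace (I'.prod 𝓘(ℝ, ℝ)) p) + v.2 * w.2)
    (k : Π z : N, TangentSpace I' z →L[ℝ] TangentSpace I' z →L[ℝ] ℝ) {C r : ℝ} (hr : 0 < r)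
    (hfam : ∀ (z : N) (τ : ℝ), τ ∈ Ioo (-r) r → ∀ v w : E',
      G.val (z, τ) ((v, 0) : TangentSpace (I'.prod 𝓘(ℝ, ℝ)) (z, τ))
        ((w, 0) : TangentSpace (I'.prod 𝓘(ℝ, ℝ)) (z, τ)) =
        (1 - C * τ ^ 2) * g₀.val z v w + τ * k z v w)
    (z : N) :
    G.scalarCurvature (z, (0 : ℝ)) =
      g₀.scalarCurvature z + 3 / 4 * g₀.normSq z ((k z).toLinearMap₁₂) -
        1 / 4 * g₀.trace z ((k z).toLinearMap₁₂) ^ 2 + 2 * C * Module.finrank ℝ E' := by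
  classical
  set hpb := contMDiff_pullbackBilin_holds (I := I'.prod 𝓘(ℝ, ℝ)) (M := N × ℝ) (I' := I') (N := N)
    (n := (∞ : ℕ∞ω)) with hpb_def
  have hfi := isSpacelikeImmersion_cylSlice G hG (0 : ℝ)
  set gN := G.inducedMetric (fun y : N ↦ ((y, (0 : ℝ)) : N × ℝ)) hpb hfi with hgN
  haveI := gN.hasLeviCivita
  set K : LinearMap.BilinForm ℝ (TangentSpace I' z) :=
    G.secondFundamentalForm I' (fun y : N ↦ ((y, (0 : ℝ)) : N × ℝ))
      (fun y ↦ velocity (I'.prod 𝓘(ℝ, ℝ)) (fun s : ℝ ↦ ((y, s) : N × ℝ)) 0) z with hKdef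
  set kb : LinearMap.BilinForm ℝ (TangentSpace I' z) := (k z).toLinearMap₁₂ with hkb
  have hkb_apply : ∀ v w, kb v w = k z v w := fun v w ↦ rfl
  have h0r : (0 : ℝ) ∈ Ioo (-r) r := ⟨by linarith, hr⟩
  -- the slice metric at `t = 0` IS `g₀`
  have hval0 : ∀ y : N, gN.val y = g₀.val y := by
    intro y
    refine ContinuousLinearMap.ext fun v ↦ ContinuousLinearMap.ext fun w ↦ ?_
    show G.val (y, (0 : ℝ)) (mfderiv I' (I'.prod 𝓘(ℝ, ℝ)) (fun y : N ↦ ((y, (0 : ℝ)) : N × ℝ)) y v)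
      (mfderiv I' (I'.prod 𝓘(ℝ, ℝ)) (fun y : N ↦ ((y, (0 : ℝ)) : N × ℝ)) y w) = g₀.val y v w
    rw [congrArg₂ (fun u u' ↦ G.val (y, (0 : ℝ)) u u') (mfderiv_cylSlice_apply (E' := E') y 0 v)
      (mfderiv_cylSlice_apply (E' := E') y 0 w), hfam y 0 h0r v w]
    ring
  have hscal : gN.scalarCurvature z = g₀.scalarCurvature z :=
    scalarCurvature_congr_of_val_eq hval0 z
  -- `K_0 = ½ k`
  have hK : ∀ v w : E', K v w = 1 / 2 * k z v w := by
    intro v w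
    have h1 := hasDerivAt_cyl_val_two_mul G hcyl z 0 v w
    have h2 : HasDerivAt (fun τ ↦ G.val (z, τ) ((v, 0) : TangentSpace (I'.prod 𝓘(ℝ, ℝ)) (z, τ))
        ((w, 0) : TangentSpace (I'.prod 𝓘(ℝ, ℝ)) (z, τ))) (k z v w - 2 * C * 0 * g₀.val z v w) 0 := by
      refine (hasDerivAt_cNormal_coeff C (g₀.val z v w) (k z v w) 0).congr_of_eventuallyEq ?_
      filter_upwards [isOpen_Ioo.mem_nhds h0r] with τ hτ
      exact hfam z τ hτ v w
    have h := h1.unique h2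
    simp only [mul_zero, zero_mul, sub_zero] at h
    show G.secondFundamentalForm I' (fun y : N ↦ ((y, (0 : ℝ)) : N × ℝ))
      (fun y ↦ velocity (I'.prod 𝓘(ℝ, ℝ)) (fun s : ℝ ↦ ((y, s) : N × ℝ)) 0) z v w = _
    linarith
  -- an orthogonal basis of `(T_zN, g_0)` = `(T_zN, g_{t=0})`
  set m := Module.finrank ℝ E' with hm_def
  have hm : Module.finrank ℝ E' = m := rfl
  obtain ⟨e, he, hde⟩ := exists_isOrthoᵢ_basis gN z
  have hfin : Module.finrank ℝ (TangentSpace I' z) = m := rfl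
  set β : Module.Basis (Fin m) ℝ (TangentSpace I' z) := e.reindex (finCongr hfin) with hβdef
  have hβapply : ∀ i, β i = e ((finCongr hfin).symm i) := fun i ↦ Module.Basis.reindex_apply _ _ _
  have hβ : (gN.toBilinForm z).IsOrthoᵢ β := by
    intro i j hij
    simp only [Function.onFun, hβapply]
    exact he fun h ↦ hij ((finCongr hfin).symm.injective h)
  have hdβ : ∀ i, gN.val z (β i) (β i) ≠ 0 := fun i ↦ by rw [hβapply]; exact hde _
  have hβ₀ : (g₀.toBilinForm z).IsOrthoᵢ β := by
    intro i j hij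
    have h := hβ hij
    simp only [Function.onFun, toBilinForm_apply] at h ⊢
    rwa [hval0 z] at h
  set a : Fin m → ℝ := fun i ↦ g₀.val z (β i) (β i) with ha_def
  have haN : ∀ i, gN.val z (β i) (β i) = a i := fun i ↦ by rw [hval0 z]
  have haG : ∀ i, G.val (z, (0 : ℝ)) ((β i, 0) : TangentSpace (I'.prod 𝓘(ℝ, ℝ)) (z, (0 : ℝ)))
      ((β i, 0) : TangentSpace (I'.prod 𝓘(ℝ, ℝ)) (z, (0 : ℝ))) = a i := fun i ↦ by
    rw [hfam z 0 h0r (β i) (β i)]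
    ring
  have hd₀ : ∀ i, a i ≠ 0 := fun i ↦ by rw [← haN i]; exact hdβ i
  -- the formula in the frame `β`
  have hmain := cyl_scalarCurvature_eq_sum G hG hcyl z 0 hm β hβ
  -- (a) `|K|² = ¼ |k|²`
  have hnormK : gN.normSq z K = ∑ i, ∑ j, K (β j) (β i) ^ 2 / (a i * a j) := by
    rw [normSq_eq_sum_sq gN z β hβ hdβ K]; simp only [haN]
  have hnormk : g₀.normSq z kb = ∑ i, ∑ j, kb (β j) (β i) ^ 2 / (a i * a j) := by
    rw [normSq_eq_sum_sq g₀ z β hβ₀ hd₀ kb]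
  have hnorm : gN.normSq z K = 1 / 4 * g₀.normSq z kb := by
    rw [hnormK, hnormk, Finset.mul_sum]
    refine Finset.sum_congr rfl fun i _ ↦ ?_
    rw [Finset.mul_sum]
    refine Finset.sum_congr rfl fun j _ ↦ ?_
    rw [hK, hkb_apply]
    ring
  -- (b) `H = ½ tr k`
  have htrace_frame : ∀ (g' : PseudoRiemannianMetric I' ∞ E' (TangentSpace I' : N → Type _))
      (hβ' : (g'.toBilinForm z).IsOrthoᵢ β) (hd' : ∀ i, g'.val z (β i) (β i) ≠ 0)
      (T : LinearMap.BilinForm ℝ (TangentSpace I' z)),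
      g'.trace z T = ∑ i, T (β i) (β i) / g'.val z (β i) (β i) := by
    intro g' hβ' hd' T
    rw [trace_eq_sum_gram_inv _ z β, gram_inv_of_isOrthoᵢ _ z β hβ' hd']
    refine Finset.sum_congr rfl fun i _ ↦ ?_
    rw [Finset.sum_eq_single i]
    · rw [Matrix.diagonal_apply_eq, inv_mul_eq_div]
    · intro j _ hji
      rw [Matrix.diagonal_apply_ne _ hji, zero_mul]
    · intro h; exact absurd (Finset.mem_univ i) h
  have hH : G.meanCurvature (fun y : N ↦ ((y, (0 : ℝ)) : N × ℝ)) hpb hfi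
      (fun y ↦ velocity (I'.prod 𝓘(ℝ, ℝ)) (fun s : ℝ ↦ ((y, s) : N × ℝ)) 0) z =
      1 / 2 * g₀.trace z kb := by
    rw [meanCurvature, htrace_frame gN hβ hdβ, htrace_frame g₀ hβ₀ hd₀, Finset.mul_sum]
    refine Finset.sum_congr rfl fun i _ ↦ ?_
    rw [haN, hkb_apply]
    show K (β i) (β i) / a i = _
    rw [hK]
    ring
  -- (c) the `g̈` term: `∑ᵢ g̈_0(βᵢ,βᵢ)/aᵢ = -2C m`
  have hdd : ∀ i, deriv (fun τ ↦ deriv (fun σ ↦ G.val (z, σ)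
      ((β i, 0) : TangentSpace (I'.prod 𝓘(ℝ, ℝ)) (z, σ))
      ((β i, 0) : TangentSpace (I'.prod 𝓘(ℝ, ℝ)) (z, σ))) τ) 0 = -2 * C * a i := by
    intro i
    have hloc : ∀ τ ∈ Ioo (-r) r, deriv (fun σ ↦ G.val (z, σ)
        ((β i, 0) : TangentSpace (I'.prod 𝓘(ℝ, ℝ)) (z, σ))
        ((β i, 0) : TangentSpace (I'.prod 𝓘(ℝ, ℝ)) (z, σ))) τ =
        deriv (fun σ : ℝ ↦ (1 - C * σ ^ 2) * a i + σ * k z (β i) (β i)) τ := by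
      intro τ hτ
      refine Filter.EventuallyEq.deriv_eq ?_
      filter_upwards [isOpen_Ioo.mem_nhds hτ] with σ hσ
      exact hfam z σ hσ (β i) (β i)
    have hev : (fun τ ↦ deriv (fun σ ↦ G.val (z, σ)
        ((β i, 0) : TangentSpace (I'.prod 𝓘(ℝ, ℝ)) (z, σ))
        ((β i, 0) : TangentSpace (I'.prod 𝓘(ℝ, ℝ)) (z, σ))) τ) =ᶠ[𝓝 0]
        fun τ ↦ deriv (fun σ : ℝ ↦ (1 - C * σ ^ 2) * a i + σ * k z (β i) (β i)) τ := by
      filter_upwards [isOpen_Ioo.mem_nhds h0r] with τ hτ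
      exact hloc τ hτ
    rw [hev.deriv_eq]
    exact (hasDerivAt_deriv_cNormal_coeff C (a i) (k z (β i) (β i)) 0).deriv
  have hddsum : ∑ i, deriv (fun τ ↦ deriv (fun σ ↦ G.val (z, σ)
      ((β i, 0) : TangentSpace (I'.prod 𝓘(ℝ, ℝ)) (z, σ))
      ((β i, 0) : TangentSpace (I'.prod 𝓘(ℝ, ℝ)) (z, σ))) τ) 0 /
      G.val (z, (0 : ℝ)) ((β i, 0) : TangentSpace (I'.prod 𝓘(ℝ, ℝ)) (z, (0 : ℝ)))
        ((β i, 0) : TangentSpace (I'.prod 𝓘(ℝ, ℝ)) (z, (0 : ℝ))) = -2 * C * m := by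
    have h : ∀ i, deriv (fun τ ↦ deriv (fun σ ↦ G.val (z, σ)
        ((β i, 0) : TangentSpace (I'.prod 𝓘(ℝ, ℝ)) (z, σ))
        ((β i, 0) : TangentSpace (I'.prod 𝓘(ℝ, ℝ)) (z, σ))) τ) 0 /
        G.val (z, (0 : ℝ)) ((β i, 0) : TangentSpace (I'.prod 𝓘(ℝ, ℝ)) (z, (0 : ℝ)))
          ((β i, 0) : TangentSpace (I'.prod 𝓘(ℝ, ℝ)) (z, (0 : ℝ))) = -2 * C := fun i ↦ by
      rw [hdd i, haG i]
      field_simp [hd₀ i]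
    simp only [h, Finset.sum_const, Finset.card_univ, Fintype.card_fin, nsmul_eq_mul]
    ring
  -- assemble
  rw [hmain, hscal, hnorm, hH, hddsum]
  ring

end Literature.Geometry.Riemannian
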